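import Summits.QuantumFields.YangMills.Theorems.BalabanLadderUVSeamRecOddCycleChessboardReach
import Summits.QuantumFields.YangMills.Theorems.BalabanLadderIROddTorusWeightedRP
import HarnessLib

/-!
# Odd-cycle chessboard WITHOUT block divisibility — part III: realisation for time-slab events of the Wilson theory on
# the odd torus `(ℤ/(2S+1))^d`

Helper file (`--supports stmt-QuantumFields-20043`, count-neutral) of seat `ym-infvol-p3` g10, completing parts I/IIa/IIb
(`…OddCycleChessboard{,Potential,Reach}.lean`).  HONEST FRAMING: finite-torus reflection-positivity bookkeeping in ONE
(the time) direction; nothing about the `d`-dimensional block version, the universal bound, E0′, the gap or Clay.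

SETTING.  The Wilson lattice gauge theory of a compact group `G` (continuous representation `ρ`, `β ≥ 0`) on the ODD torus
`(ℤ/(2S+1))^d`, `S ≥ 1` (tree: `wilsonMeasure`, `GaugeConfig.timeReflect` = the Osterwalder–Seiler reflection
`t ↦ 1 − t`, fixing the slice `t = S+1` and cutting the links `0 | 1`; its closed positive half `posHalfEdges` = the links
with both endpoints in `1 ≤ t ≤ S+1`).  A TIME-SLAB FAMILY of width `w` is `B : ℤ/(2S+1) → Set (configurations)` with
`B a` measurable and determined by the links whose two endpoints have time in `[a, a+w−1]` (`InSlab`), covariant under the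
time translations (`torusConfigShift (Pi.single 0 t)` carries `B a` to `B (a+t)`) and under the reflection
(`U.timeReflect ∈ B a ↔ U ∈ B (refl w (S+1) a)`, the mirror slab) — e.g. the translates of one reflection-symmetric seed
event of the slab `[0, w−1]`.

RESULT (`wilson_timeSlab_chessboard`).  For such a family, every `λ > 0` with
`μ(⋂_{a∈D} B a) ≤ λ^{#D}` for all compatible DENSE `D` (`(2w−2)·#D ≥ 2S+1`) satisfies `μ(⋂_{a∈A} B a) ≤ λ^{#A}` for
EVERY compatible `A` — at every odd side, prime or not.  The reflection Cauchy–Schwarz input at the Osterwalder–Seiler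
reflection is the tree's `OddTorusChessboard.sq_wilsonExpectation_mul_timeReflect_mul_expObs_le` (with no cut weight,
`c = 0`, `B = ∅`); the other reflections `y ↦ 2x − y` are reached by time translation (`wilsonMeasure_map_torusConfigShift`).

References: K. Osterwalder, E. Seiler, Ann. Phys. 110 (1978) §2; J. Fröhlich, R. Israel, E. H. Lieb, B. Simon, Commun.
Math. Phys. 62 (1978) (even side, block divisibility — not needed here).
-/

set_option autoImplicit false

noncomputable section

open Finset MeasureTheory
open Literature.MathematicalPhysics.QuantumFieldTheory
open Literature.MathematicalPhysics.QuantumFieldTheory.WilsonRP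
open Literature.MathematicalPhysics.QuantumFieldTheory.WilsonOddRP

namespace Summit.QuantumFields.YangMills.Theorems.OddCycleChessboard

section Slabs

variable {d S : ℕ} [NeZero d] {G : Type*}

/-- The site plane of the Osterwalder–Seiler reflection `t ↦ 1 − t` of the odd torus: the slice `t = S + 1`. -/
abbrev osAxis (S : ℕ) : ZMod (2 * S + 1) := (S : ZMod (2 * S + 1)) + 1

/-- **A link lies in the time slab `[a, a+w−1]`**: both endpoints have time offset `< w` from `a`. -/
def InSlab (w : ℕ) (a : ZMod (2 * S + 1)) (e : Edge d (2 * S + 1)) : Prop :=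
  (e.1 0 - a).val + 1 ≤ w ∧ ((e.1.shift e.2) 0 - a).val + 1 ≤ w

/-- The time coordinate of the tip of a link: `+1` for a time-like link, unchanged for a spatial one. -/
theorem shift_apply_zero (x : Site d (2 * S + 1)) (i : Fin d) :
    (x.shift i) 0 = if i = 0 then x 0 + 1 else x 0 := by
  unfold Site.shift
  by_cases h : i = 0
  · subst h; simp
  · rw [if_neg h, Pi.add_apply, Pi.single_eq_of_ne (Ne.symm h), add_zero]

/-- Times through offsets: if `(t − a).val = u`, `(a − osAxis S).val = v` and `2S+1 ≤ u + v + S + 1 < 2(2S+1)`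
then `t.val = u + v − S`. -/
theorem val_eq_of_offsets (hS : 1 ≤ S) {t a : ZMod (2 * S + 1)} {u v : ℕ} (hu : (t - a).val = u)
    (hv : (a - osAxis S).val = v)
    (hlo : S ≤ u + v) (hhi : u + v ≤ 2 * S + 1) : t.val = u + v - S := by
  have ht : t = ((u + v + (S + 1) : ℕ) : ZMod (2 * S + 1)) := by
    have h1 : t = (t - a) + (a - osAxis S) + osAxis S := by ring
    rw [h1, ← ZMod.natCast_zmod_val (t - a), ← ZMod.natCast_zmod_val (a - osAxis S), hu, hv]
    unfold osAxis; push_cast; ring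
  have h2 : ((u + v + (S + 1) : ℕ) : ZMod (2 * S + 1)) = ((u + v - S : ℕ) : ZMod (2 * S + 1)) := by
    have : u + v + (S + 1) = (u + v - S) + (2 * S + 1) := by omega
    rw [this, Nat.cast_add, ZMod.natCast_self, add_zero]
  rw [ht, h2, ZMod.val_cast_of_lt (by omega)]

/-- **Slabs in the closed negative half of the OS axis lie in `1 ≤ t ≤ S+1`**: every link of such a slab belongs to
`posHalfEdges`. -/
theorem mem_posHalfEdges_of_inSlab (hS : 1 ≤ S) {w : ℕ} {a : ZMod (2 * S + 1)} (ha : InMinus w (osAxis S) a)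
    {e : Edge d (2 * S + 1)} (he : InSlab w a e) :
    e ∈ (OddTorusChessboard.posHalfEdges : Finset (Edge d (2 * S + 1))) := by
  haveI : NeZero (2 * S + 1) := ⟨by omega⟩
  rw [OddTorusChessboard.posHalfEdges, mem_union, mem_oPosEdges, mem_oSharedEdges]
  unfold IsOPosEdge IsOSharedEdge
  unfold InMinus at ha
  obtain ⟨h1, h2⟩ := he
  have hdiv : (2 * S + 1) / 2 = S := by omega
  rw [hdiv]
  set u := (e.1 0 - a).val with hu
  set v := (a - osAxis S).val with hv
  have hbase : (e.1 0).val = u + v - S := val_eq_of_offsets hS hu.symm hv.symm (by omega) (by omega)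
  by_cases h0 : e.2 = 0
  · -- time-like link: the tip `base + 1` is also in the slab, so `u ≤ w - 2`
    left
    have hts : (e.1.shift e.2) 0 = e.1 0 + 1 := by rw [shift_apply_zero, if_pos h0]
    have hrel : ((e.1.shift e.2) 0 - a).val = u + 1 := by
      have : (e.1.shift e.2) 0 - a = (((u + 1 : ℕ)) : ZMod (2 * S + 1)) := by
        rw [hts, Nat.cast_add, Nat.cast_one, hu, ZMod.natCast_zmod_val]; ring
      rw [this, ZMod.val_cast_of_lt (by omega)]
    rw [hrel] at h2
    rw [hbase]; constructor <;> omega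
  · -- spatial link: time in `[1, S+1]`
    by_cases htop : (e.1 0).val = S + 1
    · right; exact ⟨h0, htop⟩
    · left; rw [hbase] at htop ⊢; constructor <;> omega

/-- The indicator of a finite intersection of slab events, as a real observable. -/
def slabInd (B : ZMod (2 * S + 1) → Set (GaugeConfig d (2 * S + 1) G)) (A : Finset (ZMod (2 * S + 1)))
    (U : GaugeConfig d (2 * S + 1) G) : ℝ := by
  classical exact if ∀ a ∈ A, U ∈ B a then 1 else 0

omit [NeZero d] in
/-- `slabInd` is the indicator of `⋂_{a∈A} B a`. -/
theorem slabInd_eq_indicator (B : ZMod (2 * S + 1) → Set (GaugeConfig d (2 * S + 1) G))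
    (A : Finset (ZMod (2 * S + 1))) :
    slabInd B A = (⋂ a ∈ A, B a).indicator 1 := by
  classical
  funext U
  unfold slabInd
  by_cases h : ∀ a ∈ A, U ∈ B a
  · rw [if_pos h, Set.indicator_of_mem (by simpa [Set.mem_iInter] using h)]; rfl
  · rw [if_neg h, Set.indicator_of_notMem (by simpa [Set.mem_iInter] using h)]

omit [NeZero d] in
/-- `slabInd` is measurable for measurable events. -/
theorem measurable_slabInd [MeasurableSpace G] {B : ZMod (2 * S + 1) → Set (GaugeConfig d (2 * S + 1) G)}
    (hBm : ∀ a, MeasurableSet (B a)) (A : Finset (ZMod (2 * S + 1))) : Measurable (slabInd B A) := by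
  rw [slabInd_eq_indicator]
  exact measurable_const.indicator (Finset.measurableSet_biInter A fun a _ => hBm a)

omit [NeZero d] in
/-- `|slabInd| ≤ 1`. -/
theorem abs_slabInd_le (B : ZMod (2 * S + 1) → Set (GaugeConfig d (2 * S + 1) G)) (A : Finset (ZMod (2 * S + 1)))
    (U : GaugeConfig d (2 * S + 1) G) : |slabInd B A U| ≤ 1 := by
  classical
  unfold slabInd; split_ifs <;> simp

omit [NeZero d] in
/-- `slabInd` of a union is the product. -/
theorem slabInd_union (B : ZMod (2 * S + 1) → Set (GaugeConfig d (2 * S + 1) G))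
    (A A' : Finset (ZMod (2 * S + 1))) (U : GaugeConfig d (2 * S + 1) G) :
    slabInd B (A ∪ A') U = slabInd B A U * slabInd B A' U := by
  classical
  unfold slabInd
  by_cases h : ∀ a ∈ A, U ∈ B a <;> by_cases h' : ∀ a ∈ A', U ∈ B a
  · rw [if_pos h, if_pos h', if_pos (fun a ha => (mem_union.1 ha).elim (h a) (h' a))]; ring
  · rw [if_pos h, if_neg h', if_neg (fun hh => h' fun a ha => hh a (mem_union_right _ ha))]; ring
  · rw [if_neg h, if_neg (fun hh => h fun a ha => hh a (mem_union_left _ ha))]; ring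
  · rw [if_neg h, if_neg (fun hh => h fun a ha => hh a (mem_union_left _ ha))]; ring

end Slabs

section Wilson

variable {d S N : ℕ} [NeZero d] {G : Type*} [Group G] [TopologicalSpace G] [IsTopologicalGroup G] [CompactSpace G]
  [MeasurableSpace G] [BorelSpace G] (ρ : G →* Matrix (Fin N) (Fin N) ℂ)

omit [NeZero d] in
/-- **The Wilson probability of a finite intersection of slab events as an expectation.** -/
theorem measureReal_biInter_eq (β : ℝ) (B : ZMod (2 * S + 1) → Set (GaugeConfig d (2 * S + 1) G))
    (hBm : ∀ a, MeasurableSet (B a)) (A : Finset (ZMod (2 * S + 1))) :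
    (wilsonMeasure (d := d) (G := G) ρ β).real (⋂ a ∈ A, B a) = wilsonExpectation ρ β (slabInd B A) := by
  rw [wilsonExpectation, slabInd_eq_indicator, integral_indicator_one
    (Finset.measurableSet_biInter A fun a _ => hBm a)]

/-- **Reflection Cauchy–Schwarz at the Osterwalder–Seiler axis** for a time-slab family: for every configuration `A`
valid for the reflection fixing `t = S+1`, `μ(⋂_A B)² ≤ μ(⋂_{symP} B) · μ(⋂_{symM} B)`. -/
theorem wilson_cs_osAxis (hS : 1 ≤ S) (hρ : Continuous ρ) {β : ℝ} (hβ : 0 ≤ β) {w : ℕ} (hw : 2 ≤ w)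
    {B : ZMod (2 * S + 1) → Set (GaugeConfig d (2 * S + 1) G)} (hBm : ∀ a, MeasurableSet (B a))
    (hBdep : ∀ a (U V : GaugeConfig d (2 * S + 1) G), (∀ e, InSlab w a e → U e = V e) → (U ∈ B a ↔ V ∈ B a))
    (hBrefl : ∀ a (U : GaugeConfig d (2 * S + 1) G), U.timeReflect ∈ B a ↔ U ∈ B (refl w (osAxis S) a))
    {A : Finset (ZMod (2 * S + 1))} (hv : Valid w (osAxis S) A) :
    (wilsonMeasure (d := d) (G := G) ρ β).real (⋂ a ∈ A, B a) ^ 2 ≤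
      (wilsonMeasure (d := d) (G := G) ρ β).real (⋂ a ∈ symP w (osAxis S) A, B a) *
        (wilsonMeasure (d := d) (G := G) ρ β).real (⋂ a ∈ symM w (osAxis S) A, B a) := by
  classical
  haveI : Fact (1 < 2 * S + 1) := ⟨by omega⟩
  haveI : NeZero (2 * S + 1) := ⟨by omega⟩
  set x₀ : ZMod (2 * S + 1) := osAxis S with hx₀
  set P := A.filter (InPlus w x₀) with hP
  set R := A.filter (fun a => ¬ InPlus w x₀ a) with hR
  have hRm : ∀ a ∈ R, InMinus w x₀ a := fun a ha => (hv a (mem_filter.1 ha).1).resolve_left (mem_filter.1 ha).2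
  -- the two half-observables
  set F : GaugeConfig d (2 * S + 1) G → ℝ := slabInd B R with hF
  set G' : GaugeConfig d (2 * S + 1) G → ℝ := slabInd B (P.image (refl w x₀)) with hG'
  -- dependence on the closed positive half
  have hdepR : ∀ A' : Finset (ZMod (2 * S + 1)), (∀ a ∈ A', InMinus w x₀ a) →
      DependsOn (slabInd B A') ((OddTorusChessboard.posHalfEdges : Finset (Edge d (2 * S + 1))) :
        Set (Edge d (2 * S + 1))) := by
    intro A' hA' U V hUV
    have key : ∀ a ∈ A', (U ∈ B a ↔ V ∈ B a) := fun a ha =>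
      hBdep a U V fun e he => hUV e (mem_coe.2 (mem_posHalfEdges_of_inSlab hS (hA' a ha) he))
    unfold slabInd
    by_cases h : ∀ a ∈ A', U ∈ B a
    · rw [if_pos h, if_pos (fun a ha => (key a ha).1 (h a ha))]
    · rw [if_neg h, if_neg (fun hh => h fun a ha => (key a ha).2 (hh a ha))]
  have hFdep := hdepR R hRm
  have hG'dep := hdepR (P.image (refl w x₀)) (fun c hc => by
    obtain ⟨a, ha, rfl⟩ := mem_image.1 hc
    exact inMinus_refl_of_inPlus hw (mem_filter.1 ha).2)
  have hcs := OddTorusChessboard.sq_wilsonExpectation_mul_timeReflect_mul_expObs_le ρ ⟨S, by ring⟩ (by omega) hρ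
    le_rfl hβ (measurable_slabInd hBm R) (abs_slabInd_le B R) hFdep
    (measurable_slabInd hBm _) (abs_slabInd_le B _) hG'dep ∅ (fun q hq => by simp at hq)
  -- identify the three expectations
  have hexp : ∀ U : GaugeConfig d (2 * S + 1) G, SoloBlind.expObs ρ 0 ∅ U = 1 := fun U => by
    simp [SoloBlind.expObs]
  have hΘ : ∀ (A' : Finset (ZMod (2 * S + 1))) (U : GaugeConfig d (2 * S + 1) G),
      slabInd B A' U.timeReflect = slabInd B (A'.image (refl w x₀)) U := by
    intro A' U
    unfold slabInd
    have : (∀ a ∈ A', U.timeReflect ∈ B a) ↔ ∀ c ∈ A'.image (refl w x₀), U ∈ B c := by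
      constructor
      · intro h c hc
        obtain ⟨a, ha, rfl⟩ := mem_image.1 hc
        exact (hBrefl a U).1 (h a ha)
      · intro h a ha
        exact (hBrefl a U).2 (h _ (mem_image_of_mem _ ha))
    by_cases h : ∀ a ∈ A', U.timeReflect ∈ B a
    · rw [if_pos h, if_pos (this.1 h)]
    · rw [if_neg h, if_neg (fun hh => h (this.2 hh))]
  have himg2 : (P.image (refl w x₀)).image (refl w x₀) = P := by
    rw [image_image]; convert image_id (s := P) using 2; funext a; simp [refl_refl]
  have hA : A = R ∪ P := by rw [hR, hP, union_comm]; exact (filter_union_filter_not_eq _ A).symm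
  have e1 : (fun U : GaugeConfig d (2 * S + 1) G => F U * G' U.timeReflect * SoloBlind.expObs ρ 0 ∅ U) =
      slabInd B A := by
    funext U; rw [hexp, mul_one, hF, hG', hΘ, himg2, hA, slabInd_union]
  have e2 : (fun U : GaugeConfig d (2 * S + 1) G => F U * F U.timeReflect * SoloBlind.expObs ρ 0 ∅ U) =
      slabInd B (symM w x₀ A) := by
    funext U; rw [hexp, mul_one, hF, hΘ, symM, ← hR, slabInd_union]
  have e3 : (fun U : GaugeConfig d (2 * S + 1) G => G' U * G' U.timeReflect * SoloBlind.expObs ρ 0 ∅ U) =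
      slabInd B (symP w x₀ A) := by
    funext U; rw [hexp, mul_one, hG', hΘ, himg2, symP, ← hP, slabInd_union, mul_comm]
  rw [e1, e2, e3, ← measureReal_biInter_eq ρ β B hBm, ← measureReal_biInter_eq ρ β B hBm,
    ← measureReal_biInter_eq ρ β B hBm] at hcs
  exact hcs.trans_eq (mul_comm _ _)

/-- Validity is transported by translation of the axis and the configuration. -/
theorem valid_image_add_iff {w : ℕ} (x t : ZMod (2 * S + 1)) (A : Finset (ZMod (2 * S + 1))) :
    Valid w (x + t) (A.image (· + t)) ↔ Valid w x A := by
  unfold Valid InPlus InMinus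
  constructor
  · intro h a ha
    have := h (a + t) (mem_image_of_mem _ ha)
    rwa [show a + t - (x + t) = a - x by ring] at this
  · intro h b hb
    obtain ⟨a, ha, rfl⟩ := mem_image.1 hb
    rw [show a + t - (x + t) = a - x by ring]
    exact h a ha

/-- `symP` is transported by translation. -/
theorem symP_image_add {w : ℕ} (x t : ZMod (2 * S + 1)) (A : Finset (ZMod (2 * S + 1))) :
    symP w (x + t) (A.image (· + t)) = (symP w x A).image (· + t) := by
  classical
  have hfilter : (A.image (· + t)).filter (InPlus w (x + t)) = (A.filter (InPlus w x)).image (· + t) := by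
    ext b
    simp only [mem_filter, mem_image, InPlus]
    constructor
    · rintro ⟨⟨a, ha, rfl⟩, hb⟩
      exact ⟨a, ⟨ha, by rwa [show a + t - (x + t) = a - x by ring] at hb⟩, rfl⟩
    · rintro ⟨a, ⟨ha, hb⟩, rfl⟩
      exact ⟨⟨a, ha, rfl⟩, by rwa [show a + t - (x + t) = a - x by ring]⟩
  rw [symP, symP, hfilter, image_union, image_image, image_image]
  congr 1
  refine image_congr fun a _ => ?_
  simp only [Function.comp_apply, refl]; ring

/-- `symM` is transported by translation. -/
theorem symM_image_add {w : ℕ} (x t : ZMod (2 * S + 1)) (A : Finset (ZMod (2 * S + 1))) :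
    symM w (x + t) (A.image (· + t)) = (symM w x A).image (· + t) := by
  classical
  have hfilter : (A.image (· + t)).filter (fun a => ¬ InPlus w (x + t) a) =
      (A.filter (fun a => ¬ InPlus w x a)).image (· + t) := by
    ext b
    simp only [mem_filter, mem_image, InPlus]
    constructor
    · rintro ⟨⟨a, ha, rfl⟩, hb⟩
      exact ⟨a, ⟨ha, by rwa [show a + t - (x + t) = a - x by ring] at hb⟩, rfl⟩
    · rintro ⟨a, ⟨ha, hb⟩, rfl⟩
      exact ⟨⟨a, ha, rfl⟩, by rwa [show a + t - (x + t) = a - x by ring]⟩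
  rw [symM, symM, hfilter, image_union, image_image, image_image]
  congr 1
  refine image_congr fun a _ => ?_
  simp only [Function.comp_apply, refl]; ring

/-- **Time-translation invariance of the intersection probabilities**: `μ(⋂_{a∈A} B (a+t)) = μ(⋂_{a∈A} B a)`. -/
theorem measureReal_biInter_image_add (β : ℝ) {B : ZMod (2 * S + 1) → Set (GaugeConfig d (2 * S + 1) G)}
    (hBm : ∀ a, MeasurableSet (B a))
    (hBshift : ∀ a (t : ZMod (2 * S + 1)) (U : GaugeConfig d (2 * S + 1) G),
      torusConfigShift (Pi.single 0 t) U ∈ B (a + t) ↔ U ∈ B a)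
    (t : ZMod (2 * S + 1)) (A : Finset (ZMod (2 * S + 1))) :
    (wilsonMeasure (d := d) (G := G) ρ β).real (⋂ a ∈ A.image (· + t), B a) =
      (wilsonMeasure (d := d) (G := G) ρ β).real (⋂ a ∈ A, B a) := by
  haveI : NeZero (2 * S + 1) := ⟨by omega⟩
  have hpre : (torusConfigShift (G := G) (Pi.single 0 t)) ⁻¹' (⋂ a ∈ A.image (· + t), B a) = ⋂ a ∈ A, B a := by
    ext U
    simp only [Set.mem_preimage, Set.mem_iInter, mem_image]
    constructor
    · intro h a ha; exact (hBshift a t U).1 (h (a + t) ⟨a, ha, rfl⟩)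
    · rintro h b ⟨a, ha, rfl⟩; exact (hBshift a t U).2 (h a ha)
  have hmeas : MeasurableSet (⋂ a ∈ A.image (· + t), B a) :=
    Finset.measurableSet_biInter _ fun a _ => hBm a
  simp only [measureReal_def]
  rw [← hpre, ← Measure.map_apply (torusConfigShift _).measurable hmeas,
    wilsonMeasure_map_torusConfigShift ρ β (Pi.single 0 t)]

/-- **The chessboard bound for time-slab events of the Wilson theory on the odd torus `(ℤ/(2S+1))^d`, `S ≥ 1`, with NO
divisibility hypothesis.**  Let `w ≥ 2`, `β ≥ 0`, `ρ` continuous, and `B` a time-slab family of width `w` (measurable,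
slab-determined, covariant under time translations and under the Osterwalder–Seiler reflection).  If `λ > 0` bounds
the dense compatible configurations, `μ(⋂_{a∈D} B a) ≤ λ^{#D}` whenever `(2w−2)·#D ≥ 2S+1`, then
`μ(⋂_{a∈A} B a) ≤ λ^{#A}` for EVERY compatible `A`. -/
theorem wilson_timeSlab_chessboard (hS : 1 ≤ S) (hρ : Continuous ρ) {β : ℝ} (hβ : 0 ≤ β) {w : ℕ} (hw : 2 ≤ w)
    {B : ZMod (2 * S + 1) → Set (GaugeConfig d (2 * S + 1) G)} (hBm : ∀ a, MeasurableSet (B a))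
    (hBdep : ∀ a (U V : GaugeConfig d (2 * S + 1) G), (∀ e, InSlab w a e → U e = V e) → (U ∈ B a ↔ V ∈ B a))
    (hBshift : ∀ a (t : ZMod (2 * S + 1)) (U : GaugeConfig d (2 * S + 1) G),
      torusConfigShift (Pi.single 0 t) U ∈ B (a + t) ↔ U ∈ B a)
    (hBrefl : ∀ a (U : GaugeConfig d (2 * S + 1) G), U.timeReflect ∈ B a ↔ U ∈ B (refl w (osAxis S) a))
    {lam : ℝ} (hlam : 0 < lam)
    (hdense : ∀ D : Finset (ZMod (2 * S + 1)), Compatible w D → 2 * S + 1 ≤ (2 * w - 2) * #D →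
      (wilsonMeasure (d := d) (G := G) ρ β).real (⋂ a ∈ D, B a) ≤ lam ^ #D)
    {A : Finset (ZMod (2 * S + 1))} (hA : Compatible w A) :
    (wilsonMeasure (d := d) (G := G) ρ β).real (⋂ a ∈ A, B a) ≤ lam ^ #A := by
  classical
  haveI : NeZero (2 * S + 1) := ⟨by omega⟩
  refine le_pow_card_oddCycle (p := fun A => (wilsonMeasure (d := d) (G := G) ρ β).real (⋂ a ∈ A, B a)) hw hlam
    (fun A _ => measureReal_nonneg) ?_ ?_ hdense hA
  · -- `p ∅ ≤ 1`
    haveI := isProbabilityMeasure_wilsonMeasure (d := d) (L := 2 * S + 1) (G := G) ρ hρ β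
    show (wilsonMeasure (d := d) (G := G) ρ β).real (⋂ a ∈ (∅ : Finset (ZMod (2 * S + 1))), B a) ≤ 1
    simp [measureReal_def]
  · -- Cauchy–Schwarz at every valid axis, by translation to the OS axis
    intro A x _ hv
    show (wilsonMeasure (d := d) (G := G) ρ β).real (⋂ a ∈ A, B a) ^ 2 ≤
      (wilsonMeasure (d := d) (G := G) ρ β).real (⋂ a ∈ symP w x A, B a) *
        (wilsonMeasure (d := d) (G := G) ρ β).real (⋂ a ∈ symM w x A, B a)
    set t : ZMod (2 * S + 1) := x - osAxis S with ht
    have hx : osAxis S + t = x := by rw [ht]; ring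
    have hback : (A.image (· + -t)).image (· + t) = A := by
      rw [image_image]; convert image_id (s := A) using 2; funext a; simp
    have hv₀ : Valid w (osAxis S) (A.image (· + -t)) := by
      rw [← valid_image_add_iff (osAxis S) t, hback, hx]; exact hv
    have h₀ := wilson_cs_osAxis ρ hS hρ hβ hw hBm hBdep hBrefl hv₀
    rw [← measureReal_biInter_image_add ρ β hBm hBshift t (A.image (· + -t)),
      ← measureReal_biInter_image_add ρ β hBm hBshift t (symP w (osAxis S) (A.image (· + -t))),
      ← measureReal_biInter_image_add ρ β hBm hBshift t (symM w (osAxis S) (A.image (· + -t))),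
      ← symP_image_add, ← symM_image_add, hback, hx] at h₀
    exact h₀

end Wilson

end Summit.QuantumFields.YangMills.Theorems.OddCycleChessboard
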